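import Literature.Combinatorics.LorentzianPolynomials.Bivariate
import Literature.Combinatorics.LorentzianPolynomials.StrictlyLorentzianQuadratic
import HarnessLib

/-!
# Brändén–Huh Example 2.3: the strictly Lorentzian bivariate forms

Layer `Literature/Combinatorics/LorentzianPolynomials`, namespace `Literature.Combinatorics.LorentzianPolynomials`;
lane `lit-hodgefound` (Track 2 foundations library), seat p16, generation 29 (row g29-#12). The tree's `Bivariate.lean`
(gen 28) proves Example 2.26 (a bivariate form is LORENTZIAN iff its coefficient sequence is ultra log-concave without
internal zeros) and records Example 2.3 — the STRICT version — as "NOT claimed … strictly Lorentzian polynomials are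
not [in the tree]". They are now (`LorentzianClosed.strictlyLorentzian`, Definition 2.1, with the second description
`StrictlyLorentzianQuadratic.mem_strictlyLorentzian_iff_forall_iterPderiv`), and this file proves Example 2.3.

## Source (verbatim) — P. Brändén, J. Huh, *Lorentzian polynomials* [BrandenHuh2019] (held `paper:arxiv-1902.03719`)

§2.1, Example 2.3 (p. 9): "Consider the homogeneous bivariate polynomial with positive coefficients
`f = Σ_{k=0}^d a_k w_1^k w_2^{d-k}`. Computing the partial derivatives of `f` reveals that `f` is strictly Lorentzian if
and only if `a_k² / C(d,k)² > (a_{k-1} / C(d,k-1)) (a_{k+1} / C(d,k+1))` for all `0 < k < d`."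

§2.1, Definition 2.1 (p. 8): "`L̊²_n = {f ∈ P²_n | 𝓗_f is nonsingular and has exactly one positive eigenvalue}` […] the
polynomial `∂^α f` is a quadratic form […] `f ∈ P^d_n | ∂^α f ∈ L̊²_n for all α ∈ Δ^{d-2}_n`."

## What is here

* §1 `IsStrictlyUltraLogConcave` (the displayed strict inequalities) and its reading through the normalized
  coefficients `c_k = k!(d-k)! a_k`: `c_{k-1} c_{k+1} < c_k²` (`isStrictlyUltraLogConcave_iff_normCoeff`).
* §2 "Computing the partial derivatives": the coefficients of `∂^α f` are positive (`coeff_iterPderiv_pos`), and a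
  binary quadratic form `q ∈ P²_2` lies in `L̊²_2` iff `𝓗_{00} 𝓗_{11} < 𝓗_{01}²` (`mem_strictlyLorentzian_two_iff_of_fin_two`,
  from `StrictlyLorentzianQuadratic.mem_strictlyLorentzian_two_iff_forall_mul_lt_sq`).
* §3 **Example 2.3** (`bivariate_mem_strictlyLorentzian_iff`): for positive `a_0, …, a_d`, `Σ a_k w_0^k w_1^{d-k} ∈ L̊^d_2`
  iff `(a_k)` is strictly ultra log-concave — via the second description of Definition 2.1 and the Hessians
  `((c_{k+2}, c_{k+1}), (c_{k+1}, c_k))` of the `∂^α f` (`Bivariate.hessian_iterPderiv_bivariate`).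

Theorems and one definition with body; no `sorry`, no named fact (net debt 0).

## References

* [BrandenHuh2019] P. Brändén, J. Huh, *Lorentzian polynomials*, Ann. of Math. (2) 192 (2020) 821–891,
  arXiv:1902.03719 — §2.1 Def. 2.1, Example 2.3 (pp. 8–9); §2.4 Example 2.26.
-/

noncomputable section

open MvPolynomial Finsupp Finset
open scoped Nat
open Literature.LinearAlgebra.QuadraticForm

namespace Literature.Combinatorics.LorentzianPolynomials

/-! ## §1 Strict ultra log-concavity -/

section StrictULC

/-- **Strictly ultra log-concave sequence** `a_0, …, a_d`: "`a_k² / C(d,k)² > (a_{k-1}/C(d,k-1)) (a_{k+1}/C(d,k+1))` for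
all `0 < k < d`" — the condition of Example 2.3. [cite: BrandenHuh2019, §2.1 Example 2.3 (p. 9)] -/
def IsStrictlyUltraLogConcave (d : ℕ) (a : ℕ → ℝ) : Prop :=
  ∀ k, 0 < k → k < d → (a (k - 1) / d.choose (k - 1)) * (a (k + 1) / d.choose (k + 1)) < (a k / d.choose k) ^ 2

/-- Unfolding `IsStrictlyUltraLogConcave`. [cite: BrandenHuh2019, §2.1 Example 2.3 (p. 9)] -/
theorem isStrictlyUltraLogConcave_iff {d : ℕ} {a : ℕ → ℝ} : IsStrictlyUltraLogConcave d a ↔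
    ∀ k, 0 < k → k < d → (a (k - 1) / d.choose (k - 1)) * (a (k + 1) / d.choose (k + 1)) < (a k / d.choose k) ^ 2 :=
  Iff.rfl

/-- A strictly ultra log-concave sequence is ultra log-concave. [cite: BrandenHuh2019, §2.1 Example 2.3; §2.4
Example 2.26] -/
theorem IsStrictlyUltraLogConcave.isUltraLogConcave {d : ℕ} {a : ℕ → ℝ} (h : IsStrictlyUltraLogConcave d a) :
    IsUltraLogConcave d a :=
  fun k hk hkd ↦ (h k hk hkd).le

/-- **Strict ultra log-concavity through the normalized coefficients** `c_k = c_{(k,d-k)} = k!(d-k)! a_k`: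
`c_{k-1} c_{k+1} < c_k²` for `0 < k < d`. [cite: BrandenHuh2019, §2.1 Example 2.3 ("Computing the partial derivatives of
`f` reveals […]")] -/
theorem isStrictlyUltraLogConcave_iff_normCoeff {d : ℕ} {a : ℕ → ℝ} : IsStrictlyUltraLogConcave d a ↔
    ∀ k, 0 < k → k < d →
      normCoeff (bideg (k - 1) (d - (k - 1))) (bivariate d a) * normCoeff (bideg (k + 1) (d - (k + 1))) (bivariate d a) <
        normCoeff (bideg k (d - k)) (bivariate d a) ^ 2 := by
  refine forall₃_congr fun k hk hkd ↦ ?_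
  rw [normCoeff_bivariate_bideg a (by omega), normCoeff_bivariate_bideg a (by omega), normCoeff_bivariate_bideg a hkd.le,
    factorial_mul_factorial_eq_div (by omega : k - 1 ≤ d), factorial_mul_factorial_eq_div (by omega : k + 1 ≤ d),
    factorial_mul_factorial_eq_div hkd.le]
  have hd : (0 : ℝ) < d ! := Nat.cast_pos.2 (Nat.factorial_pos d)
  rw [show (d ! : ℝ) / d.choose (k - 1) * a (k - 1) * ((d ! : ℝ) / d.choose (k + 1) * a (k + 1)) =
      (d ! : ℝ) ^ 2 * ((a (k - 1) / d.choose (k - 1)) * (a (k + 1) / d.choose (k + 1))) by ring,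
    show ((d ! : ℝ) / d.choose k * a k) ^ 2 = (d ! : ℝ) ^ 2 * (a k / d.choose k) ^ 2 by ring]
  exact ⟨fun h ↦ mul_lt_mul_of_pos_left h (pow_pos hd 2), fun h ↦ lt_of_mul_lt_mul_left h (pow_pos hd 2).le⟩

end StrictULC

/-! ## §2 "Computing the partial derivatives": `∂^α f ∈ P²`, and `L̊²_2` -/

section Derivatives

variable {σ : Type*} [Fintype σ]

/-- `Π_j (α_j + β_j)_{(α_j)} > 0`. [cite: BrandenHuh2019, §2.1 (p. 8, `∂^α = Π ∂_i^{α_i}`)] -/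
theorem descFactorialProd_add_pos (α β : σ →₀ ℕ) : 0 < descFactorialProd (α + β) α := by
  rw [descFactorialProd]
  refine Finset.prod_pos fun j _ ↦ ?_
  have h : (α + β) j = α j + β j := rfl
  rw [h]
  exact_mod_cast Nat.pos_of_ne_zero fun h0 ↦ by
    rw [Nat.descFactorial_eq_zero_iff_lt] at h0
    omega

/-- **`f ∈ P^d_n ⟹ ∂^α f ∈ P^{d-|α|}_n`**: all the coefficients of degree `m` of `∂^α f` are positive when those of
degree `|α| + m` of `f` are. [cite: BrandenHuh2019, §2.1 Def. 2.1, Example 2.3 ("Computing the partial derivatives")] -/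
theorem coeff_iterPderiv_pos {f : MvPolynomial σ ℝ} {d m : ℕ} (hpos : ∀ γ : σ →₀ ℕ, γ.degree = d → 0 < coeff γ f)
    {α : σ →₀ ℕ} (hα : α.degree + m = d) (β : σ →₀ ℕ) (hβ : β.degree = m) : 0 < coeff β (iterPderiv α f) := by
  rw [coeff_iterPderiv]
  exact mul_pos (descFactorialProd_add_pos α β) (hpos _ (by rw [map_add]; omega))

/-- **`L̊²_2` read off the Hessian**: a binary quadratic form `q` with positive coefficients is strictly Lorentzian iff
`𝓗_{00} 𝓗_{11} < 𝓗_{01}²` (a `2 × 2` symmetric matrix with positive entries is nonsingular with exactly one positive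
eigenvalue iff its determinant is negative). Via Lemma 2.5's open form with `u = e_0`:
`(𝓗(v, e_0))² - 𝓗(v, v) 𝓗_{00} = v_1² (𝓗_{01}² - 𝓗_{00} 𝓗_{11})`. [cite: BrandenHuh2019, §2.1 Def. 2.1 (`L̊²_n`),
Example 2.3] -/
theorem mem_strictlyLorentzian_two_iff_of_fin_two {q : MvPolynomial (Fin 2) ℝ} (hq : q.IsHomogeneous 2)
    (hpos : ∀ α : Fin 2 →₀ ℕ, α.degree = 2 → 0 < coeff α q) :
    q ∈ strictlyLorentzian (Fin 2) 2 ↔ hessian q 0 0 * hessian q 1 1 < hessian q 0 1 ^ 2 := by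
  classical
  set M := hessian q with hM
  have hsymm : M 1 0 = M 0 1 := (isSymm_hessian q).apply 0 1
  have hB : ∀ x y : Fin 2 → ℝ, Matrix.toBilin' M x y =
      x 0 * M 0 0 * y 0 + x 0 * M 0 1 * y 1 + x 1 * M 0 1 * y 0 + x 1 * M 1 1 * y 1 := fun x y ↦ by
    rw [Matrix.toBilin'_apply, Fin.sum_univ_two, Fin.sum_univ_two, Fin.sum_univ_two, hsymm]
    ring
  have h00 : 0 < Matrix.toBilin' M (Pi.single 0 1) (Pi.single 0 1) := toBilin'_hessian_single_single_pos hpos 0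
  have he0 : ∀ x : Fin 2 → ℝ, Matrix.toBilin' M x (Pi.single 0 1) = x 0 * M 0 0 + x 1 * M 0 1 := fun x ↦ by
    rw [hB]
    simp
  have he00 : Matrix.toBilin' M (Pi.single 0 1) (Pi.single 0 1) = M 0 0 := by
    rw [he0]
    simp
  rw [mem_strictlyLorentzian_two_iff_forall_mul_lt_sq hq hpos h00]
  constructor
  · intro h
    have h1 : ∀ t : ℝ, (Pi.single 1 1 : Fin 2 → ℝ) ≠ t • Pi.single 0 1 := fun t ht ↦ by
      have h' := congr_fun ht 1
      simp at h'
    have h2 := h _ h1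
    rw [he00, he0, hB] at h2
    simp only [Pi.single_eq_same, Fin.isValue, ne_eq, one_ne_zero, not_false_eq_true, Pi.single_eq_of_ne',
      zero_mul, mul_zero, add_zero, zero_add, one_mul, mul_one] at h2
    rw [mul_comm]
    convert h2 using 2
  · intro hlt v hv
    have hv1 : v 1 ≠ 0 := fun h0 ↦ hv (v 0) (by
      ext k
      fin_cases k
      · simp
      · simp [h0])
    rw [he00, he0, hB]
    have hsq : 0 < v 1 ^ 2 := lt_of_le_of_ne (sq_nonneg _) (Ne.symm (pow_ne_zero 2 hv1))
    have key : (v 0 * M 0 0 + v 1 * M 0 1) ^ 2 -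
        (v 0 * M 0 0 * v 0 + v 0 * M 0 1 * v 1 + v 1 * M 0 1 * v 0 + v 1 * M 1 1 * v 1) * M 0 0 =
        v 1 ^ 2 * (M 0 1 ^ 2 - M 0 0 * M 1 1) := by ring
    exact sub_pos.1 (key ▸ mul_pos hsq (sub_pos.2 hlt))

end Derivatives

/-! ## §3 Example 2.3 -/

section Example23

/-- **Brändén–Huh, Example 2.3.** For POSITIVE `a_0, …, a_d`, the bivariate form `f = Σ_{k=0}^d a_k w_0^k w_1^{d-k}` is
strictly Lorentzian (`∈ L̊^d_2`, Definition 2.1) **if and only if**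
`a_k² / C(d,k)² > (a_{k-1}/C(d,k-1)) (a_{k+1}/C(d,k+1))` for all `0 < k < d`. "Computing the partial derivatives": by the
second description of Definition 2.1, `f ∈ L̊^d_2` iff every `∂^α f ∈ L̊²_2` (`|α| = d - 2`), whose Hessian is
`((c_{k+1}, c_k), (c_k, c_{k-1}))`, `k = α_0 + 1`, and a positive symmetric `2 × 2` matrix is nonsingular with exactly
one positive eigenvalue iff `c_{k-1} c_{k+1} < c_k²`. [cite: BrandenHuh2019, §2.1 Example 2.3 (p. 9)] -/
theorem bivariate_mem_strictlyLorentzian_iff {d : ℕ} {a : ℕ → ℝ} (ha : ∀ k ≤ d, 0 < a k) :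
    bivariate d a ∈ strictlyLorentzian (Fin 2) d ↔ IsStrictlyUltraLogConcave d a := by
  classical
  have hhom := isHomogeneous_bivariate d a
  have hpos : ∀ β : Fin 2 →₀ ℕ, β.degree = d → 0 < coeff β (bivariate d a) := fun β hβ ↦ by
    rw [coeff_bivariate, if_pos hβ]
    have := degree_eq_add β
    exact ha _ (by omega)
  match d, hhom, hpos with
  | 0, hhom, hpos =>
    exact ⟨fun _ k hk hkd ↦ absurd hkd (by omega), fun _ ↦ mem_strictlyLorentzian_zero.2 ⟨hhom, hpos⟩⟩
  | 1, hhom, hpos =>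
    exact ⟨fun _ k hk hkd ↦ absurd hkd (by omega), fun _ ↦ mem_strictlyLorentzian_one.2 ⟨hhom, hpos⟩⟩
  | m + 2, hhom, hpos =>
    rw [mem_strictlyLorentzian_iff_forall_iterPderiv, and_iff_right ⟨hhom, hpos⟩, isStrictlyUltraLogConcave_iff_normCoeff]
    -- the `∂^α f`, `|α| = m`, are binary quadratic forms with positive coefficients
    have hq : ∀ α : Fin 2 →₀ ℕ, α.degree = m → (iterPderiv α (bivariate (m + 2) a)).IsHomogeneous 2 := fun α hα ↦
      IsHomogeneous.iterPderiv α (by rw [hα, add_comm 2 m]; exact hhom)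
    have hqpos : ∀ α : Fin 2 →₀ ℕ, α.degree = m → ∀ β : Fin 2 →₀ ℕ, β.degree = 2 →
        0 < coeff β (iterPderiv α (bivariate (m + 2) a)) := fun α hα β hβ ↦
      coeff_iterPderiv_pos hpos (by rw [hα]) β hβ
    constructor
    · intro h k hk hkd
      have hα : (bideg (k - 1) (m + 1 - k)).degree = m := by rw [degree_bideg]; omega
      have h2 := (mem_strictlyLorentzian_two_iff_of_fin_two (hq _ hα) (hqpos _ hα)).1 (h _ hα)
      obtain ⟨h00, h01, h11⟩ := hessian_iterPderiv_bivariate a (rfl : m + 2 = m + 2) hα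
      rw [h00, h01, h11, bideg_apply_zero, show k - 1 + 2 = k + 1 by omega, show k - 1 + 1 = k by omega,
        mul_comm] at h2
      exact h2
    · intro h α hα
      have hα' := degree_eq_add α
      refine (mem_strictlyLorentzian_two_iff_of_fin_two (hq _ hα) (hqpos _ hα)).2 ?_
      obtain ⟨h00, h01, h11⟩ := hessian_iterPderiv_bivariate a (rfl : m + 2 = m + 2) hα
      have hk := h (α 0 + 1) (by omega) (by omega)
      rw [show α 0 + 1 - 1 = α 0 by omega, show α 0 + 1 + 1 = α 0 + 2 by omega] at hk
      rw [h00, h01, h11, mul_comm]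
      exact hk

/-- Example 2.3 for a homogeneous binary form given abstractly. [cite: BrandenHuh2019, §2.1 Example 2.3] -/
theorem mem_strictlyLorentzian_iff_of_isHomogeneous_fin_two {d : ℕ} {f : MvPolynomial (Fin 2) ℝ}
    (hf : f.IsHomogeneous d) (hpos : ∀ β : Fin 2 →₀ ℕ, β.degree = d → 0 < coeff β f) :
    f ∈ strictlyLorentzian (Fin 2) d ↔ IsStrictlyUltraLogConcave d fun k ↦ coeff (bideg k (d - k)) f := by
  have ha : ∀ k ≤ d, 0 < coeff (bideg k (d - k)) f := fun k hk ↦ hpos _ (by rw [degree_bideg]; omega)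
  rw [← bivariate_mem_strictlyLorentzian_iff ha, ← eq_bivariate_of_isHomogeneous hf]

end Example23

end Literature.Combinatorics.LorentzianPolynomials

end
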